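import Mathlib.Combinatorics.Hall.Basic
import Mathlib.Data.Finset.Sups
import Mathlib.Order.UpperLower.Basic
import Summits.CriticalPhenomena.PercolationContinuityZ3.Theorems.PercNearOneGluingNoHeavyLowerTailAntiBandMatching

/-!
# `NoHeavyLowerTail` (crux stmt-CriticalPhenomena-4575), lane prim-ineq-gen-4 (gen 33): the anti-band inequality from HALL'S CONDITION on the cover graph

Support file (`--supports stmt-CriticalPhenomena-4575`; memo `run/shared/lean/prim/prim-ineq-gen-4/FINDING-THRESHOLD-JUNTA-g33.md` §2.7).
Pure finite combinatorics, no definitions, no `sorry`, standard axioms.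

Gen 21 reduced (AB_l) for a family `W` (and every up-set `V`) to a *covering map* of the outer part `W' = {s ∈ W | #s < l ∨ #sᶜ < l}`; gen 32/33 proved
Hall-type inequalities `#X ≤ #{v ∈ W' | ∃ x ∈ X, xᶜ ⊆ v}` for special `X ⊆ W'` (pure, no band difference, one small / one huge member:
`AntiBandCoverMatching.card_le_card_cover_targets*`).  This file closes the formal loop: by Hall's marriage theorem
(`Finset.all_card_le_biUnion_card_iff_exists_injective`) the Hall condition for ALL `X ⊆ W'` yields a covering map, hence (AB_l) for `W` and every
up-set `V` (`antiBand_of_hall`).  So (AB_l)(n) for an up-set `W` is literally the statement that every `X ⊆ W ∩ O` has at least `#X` members of `W ∩ O`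
above the complement of one of its members — the form in which the lane's memos state the open "mixed" case.
-/

namespace Summit.CriticalPhenomena.PercolationContinuityZ3.Theorems.AntiBandHall

open Finset
open scoped FinsetFamily

variable {β : Type*} [DecidableEq β] [Fintype β]

/-- **(AB_l) from Hall's condition on the cover graph.**  Let `W' = {s ∈ W | #s < l ∨ #sᶜ < l}`.  If every `X ⊆ W'` satisfies
`#X ≤ #{v ∈ W' | ∃ x ∈ X, xᶜ ⊆ v}`, then for every up-set `V`: `#{s ∈ W ∩ Vᶜˢ | #s < l ∨ #sᶜ < l} ≤ #{s ∈ W ∩ V | #s < l ∨ #sᶜ < l}`.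
(Hall's marriage theorem gives an injection `Φ : W' → W'` with `sᶜ ⊆ Φ s`; then gen 21's `AntiBandMatching.antiBand_of_covering_map`.) [this work] -/
theorem antiBand_of_hall (l : ℕ) (W V : Finset (Finset β)) (hV : IsUpperSet (V : Set (Finset β)))
    (hHall : ∀ X ⊆ W.filter (fun s => #s < l ∨ #sᶜ < l),
      #X ≤ #((W.filter fun s => #s < l ∨ #sᶜ < l).filter fun v => ∃ x ∈ X, xᶜ ⊆ v)) :
    #((W ∩ Vᶜˢ).filter fun s => #s < l ∨ #sᶜ < l) ≤ #((W ∩ V).filter fun s => #s < l ∨ #sᶜ < l) := by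
  classical
  set W' := W.filter (fun s => #s < l ∨ #sᶜ < l) with hW'def
  -- Hall's theorem on the relation `xᶜ ⊆ v` inside `W'`
  let t : W' → Finset (Finset β) := fun x => W'.filter fun v => (x : Finset β)ᶜ ⊆ v
  have hH : ∀ S : Finset W', #S ≤ #(S.biUnion t) := by
    intro S
    set X : Finset (Finset β) := S.map (Function.Embedding.subtype _) with hXdef
    have hXW : X ⊆ W' := fun u hu => by obtain ⟨a, -, rfl⟩ := mem_map.1 hu; exact a.2
    have h1 := hHall X hXW
    have h2 : (W'.filter fun v => ∃ x ∈ X, xᶜ ⊆ v) ⊆ S.biUnion t := by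
      intro v hv
      rw [mem_filter] at hv
      obtain ⟨hvW, x, hx, hxv⟩ := hv
      obtain ⟨a, ha, hax⟩ := mem_map.1 hx
      rw [mem_biUnion]
      refine ⟨a, ha, ?_⟩
      show v ∈ W'.filter fun v => (a : Finset β)ᶜ ⊆ v
      rw [mem_filter]
      have : (a : Finset β) = x := hax
      rw [this]
      exact ⟨hvW, hxv⟩
    calc #S = #X := (card_map _).symm
      _ ≤ _ := h1
      _ ≤ #(S.biUnion t) := card_le_card h2
  obtain ⟨f, hfinj, hft⟩ := (all_card_le_biUnion_card_iff_exists_injective t).1 hH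
  let Φ : Finset β → Finset β := fun s => if h : s ∈ W' then f ⟨s, h⟩ else s
  refine AntiBandMatching.antiBand_of_covering_map l W V hV Φ (fun s hs => ?_) (fun s hs => ?_) ?_
  · have hs' : s ∈ W' := hs
    simp only [Φ, dif_pos hs']
    exact (mem_filter.1 (hft ⟨s, hs'⟩)).1
  · have hs' : s ∈ W' := hs
    simp only [Φ, dif_pos hs']
    exact (mem_filter.1 (hft ⟨s, hs'⟩)).2
  · intro s hs s' hs' h
    have hsW : s ∈ W' := hs
    have hs'W : s' ∈ W' := hs'
    simp only [Φ, dif_pos hsW, dif_pos hs'W] at h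
    exact congrArg Subtype.val (hfinj h)

end Summit.CriticalPhenomena.PercolationContinuityZ3.Theorems.AntiBandHall
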